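import Summits.RiemannHypothesis.RiemannHypothesis.Theorems.SuzukiStructureFunctionsWindowFourier
import Summits.RiemannHypothesis.RiemannHypothesis.Theorems.SuzukiStructureFunctionsZetaRegularity
import HarnessLib

/-!
# SuzukiStructureFunctionsCanonicalSystem — Thm. 3.1 (4) for `C¹` kernels: `ᵗ(A(t,z), B(t,z))` solves the canonical
# system `∂_tA = zγ(t)B`, `∂_tB = −zγ(t)⁻¹A` (`γ = m²`) at every `t` of a clean range `(0,τ)`; hence Suzuki's Thm. 2.2
# dynamics for `ζ` (`ω ≥ ½`, `ν ≥ 1`, `νω > 2`) UNCONDITIONALLY (column DBR; RH-FREE)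

LINE 1 — LABEL: RH-FREE (algebra on top of …WindowFourier: the window Fourier formula for `𝔄, 𝔅` on all of `ℂ` and the
`t`-derivative of the window transforms; `m′ = μm` from …MuContinuity; the ONLY `ζ` inputs are the classical ones behind
`isSuzukiPair_zeta`, `contDiff_suzukiKernel` and `suzuki2021_windows_of_half_le'` — zero-free half-plane `Re s > 1`,
strip decay of `ξ`, no unit eigenvalues for `ω ≥ ½`); bears_on LADDER-RH B-D → B-P(P1)/(P3): this DISCHARGES, for every
`C¹` kernel vanishing on `(−∞,0]` (in particular for `K_ζ^{ω,ν}`, `νω > 2`), the third and last conjunct of the typed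
residual `SuzukiStructure.Suzuki2021_thm31_dynamics` (canonical system off a discrete set — here the set is EMPTY);
with …StructContinuity (conjuncts 1–2) the residual's full conclusion holds for `C¹` kernels
(`thm31_dynamics_of_contDiff`), and Suzuki's Thm. 2.2 («`E_ζ^{ω,ν}(t,z)` solves the canonical system associated with
`H_ζ^{ω,ν}` on `t ∈ [0,∞)`») holds for `νω > 2` with no hypothesis (`solvesCanonicalSystemOn_zeta`, `thm22_dynamics_zeta`).
WHAT THIS IS NOT: not progress toward RH; nothing here concerns `t → ∞`, the `J`-limits, `E_ζ(t,·) ∈ ℍ𝔹̄` or Thm. 2.4 —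
the GRH-equivalent boundary stays untouched; the named fact for merely piecewise-`C¹` kernels ((K4) with `Λ ≠ ∅`,
e.g. `1 < νω ≤ 2`) is NOT asserted.

Source: M. Suzuki, J. Funct. Anal. 281 (2021) 109116 = arXiv:1606.05726 [Suzuki2021Hamiltonians], Thm. 3.1 (4),
§3.6 (3.30)–(3.38) («we can verify that (3.31) and (3.37) imply that `ᵗ(A(t,z),B(t,z))` satisfies the canonical
system … by elementary ways»), Thm. 2.2.

Contents (seat rh-dbr-eng-5 g7): **`hasDerivAt_frakA`** (`∂_t𝔄 = z𝔅 − μ𝔄`), **`hasDerivAt_frakB`**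
(`∂_t𝔅 = −z𝔄 + μ𝔅`), **`thm31_canonical_system`**, **`thm31_dynamics_of_contDiff`** (the residual's conclusion for `C¹`
kernels, `D = ∅`), **`solvesCanonicalSystemOn_zeta`** (Thm. 2.2 dynamics on `(0,∞)`, `νω > 2`), `thm22_dynamics_zeta`.
-/

noncomputable section

-- D-0017: `Summit.<S>.<S>.…` is the designed namespace of a single-problem summit.
set_option linter.dupNamespace false

open MeasureTheory Set Filter Topology Function Complex
open scoped ENNReal RealInnerProductSpace

namespace Summit.RiemannHypothesis.RiemannHypothesis.Theorems.SuzukiStructureFunctions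

open Literature.Analysis.OperatorTheory Literature.NumberTheory.LFunctions
  Literature.NumberTheory.LFunctions.SuzukiStructure
open Summit.RiemannHypothesis.RiemannHypothesis.Theorems.SuzukiPhiExistence
  (continuous_suzukiPhiExt exists_isSuzukiPhiSolution_of_noUnitEigenvalue)

variable {ϱ K : ℝ → ℝ} {t : ℝ}

/-! ## §29 Thm. 3.1 (4) for `C¹` kernels: `∂_t𝔄 = z𝔅 − μ𝔄`, `∂_t𝔅 = −z𝔄 + μ𝔅`, hence the canonical system
`∂_tA(t,z) = zγ(t)B(t,z)`, `∂_tB(t,z) = −zγ(t)⁻¹A(t,z)` at EVERY `t` of a clean range `(0,τ)` (no exceptional set);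
the typed residual's conclusion for `C¹` kernels; Suzuki's Thm. 2.2 dynamics for `ζ` (`νω > 2`), unconditionally -/

/-- RH-FREE. `∂_t𝔄(t,z) = z𝔅(t,z) − μ(t)𝔄(t,z)` on a clean range, for a Suzuki pair with `K ∈ C¹`. -/
theorem hasDerivAt_frakA (h : IsSuzukiPair ϱ K) (hKd : ContDiff ℝ 1 K) {τ : ℝ}
    (hclean : ∀ s : ℝ, s ∈ Ico 0 τ → NoUnitEigenvalue K s) (ht : t ∈ Ioo 0 τ) (z : ℂ) :
    HasDerivAt (fun s : ℝ => frakA ϱ K s z) (z * frakB ϱ K t z - (mu K t : ℂ) * frakA ϱ K t z) t := by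
  have hK0 : ∀ u : ℝ, u ≤ 0 → K u = 0 := h.kernel_eq_zero
  have hsol : ∀ (ε : ℝ), (ε = 1 ∨ ε = -1) → ∀ s : ℝ, s ∈ Ioo 0 τ → ∃ X : ℝ → ℝ, IsSuzukiPhiSolution K ε s X :=
    fun ε hε s hs => exists_isSuzukiPhiSolution_of_noUnitEigenvalue h.continuous_kernel hK0 hε
      (hclean s ⟨hs.1.le, hs.2⟩)
  have hP : ∀ (ε s : ℝ) (w : ℂ), (∫ y in Ioo (-s) s, (suzukiPhiExt K ε s y : ℂ) * cexp (I * w * y)) =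
      ∫ y in Ioo (-s) s, cexp (I * w * y) * (suzukiPhiExt K ε s y : ℂ) :=
    fun ε s w => setIntegral_congr_fun measurableSet_Ioo fun y _ => mul_comm _ _
  -- the window model of `𝔄(s,z)` on the clean range
  have hmodel : ∀ s : ℝ, s ∈ Ioo 0 τ → frakA ϱ K s z =
      1 / 2 * (cexp (I * z * s) * fourier ϱ z + cexp (I * (-z) * s) * fourier ϱ (-z)) -
        1 / 2 * (fourier ϱ z * (∫ y in Ioo (-s) s, cexp (I * z * y) * (suzukiPhiExt K 1 s y : ℂ)) +
          fourier ϱ (-z) * ∫ y in Ioo (-s) s, cexp (I * (-z) * y) * (suzukiPhiExt K 1 s y : ℂ)) := by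
    intro s hs
    rw [frakA_def, frakF_def, fourier_frakFG_eq_window h (hsol 1 (Or.inl rfl) s hs) z, hP, hP]
    push_cast
    ring
  have d1 := hasDerivAt_cexp_I_mul_ofReal z t
  have d2 := hasDerivAt_cexp_I_mul_ofReal (-z) t
  have d3 := hasDerivAt_window_transform (ε := 1) hKd hK0 (Or.inl rfl) hclean ht z
  have d4 := hasDerivAt_window_transform (ε := 1) hKd hK0 (Or.inl rfl) hclean ht (-z)
  have hD := (((d1.mul_const (fourier ϱ z)).add (d2.mul_const (fourier ϱ (-z)))).const_mul (1 / 2 : ℂ)).sub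
    ((((d3.const_mul (fourier ϱ z)).add (d4.const_mul (fourier ϱ (-z)))).const_mul (1 / 2 : ℂ)))
  have hEq : (fun s : ℝ => frakA ϱ K s z) =ᶠ[𝓝 t] fun s : ℝ =>
      1 / 2 * (cexp (I * z * s) * fourier ϱ z + cexp (I * (-z) * s) * fourier ϱ (-z)) -
        1 / 2 * (fourier ϱ z * (∫ y in Ioo (-s) s, cexp (I * z * y) * (suzukiPhiExt K 1 s y : ℂ)) +
          fourier ϱ (-z) * ∫ y in Ioo (-s) s, cexp (I * (-z) * y) * (suzukiPhiExt K 1 s y : ℂ)) := by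
    filter_upwards [Ioo_mem_nhds ht.1 ht.2] with s hs
    exact hmodel s hs
  refine (hD.congr_of_eventuallyEq hEq).congr_deriv ?_
  -- `𝔅(t,z)` through the window
  have hB : frakB ϱ K t z = I * (1 / 2 * (cexp (I * z * t) * fourier ϱ z + (-1 : ℝ) *
      (cexp (I * (-z) * t) * fourier ϱ (-z))) - (-1 : ℝ) / 2 * (fourier ϱ z *
        (∫ y in Ioo (-t) t, cexp (I * z * y) * (suzukiPhiExt K (-1) t y : ℂ)) + (-1 : ℝ) *
          (fourier ϱ (-z) * ∫ y in Ioo (-t) t, cexp (I * (-z) * y) * (suzukiPhiExt K (-1) t y : ℂ)))) := by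
    rw [frakB_def, frakG_def, fourier_frakFG_eq_window h (hsol (-1) (Or.inr rfl) t ht) z, hP, hP]
  rw [hB, hmodel t ht]
  push_cast
  ring

/-- RH-FREE. `∂_t𝔅(t,z) = −z𝔄(t,z) + μ(t)𝔅(t,z)` on a clean range, for a Suzuki pair with `K ∈ C¹`. -/
theorem hasDerivAt_frakB (h : IsSuzukiPair ϱ K) (hKd : ContDiff ℝ 1 K) {τ : ℝ}
    (hclean : ∀ s : ℝ, s ∈ Ico 0 τ → NoUnitEigenvalue K s) (ht : t ∈ Ioo 0 τ) (z : ℂ) :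
    HasDerivAt (fun s : ℝ => frakB ϱ K s z) (-(z * frakA ϱ K t z) + (mu K t : ℂ) * frakB ϱ K t z) t := by
  have hK0 : ∀ u : ℝ, u ≤ 0 → K u = 0 := h.kernel_eq_zero
  have hsol : ∀ (ε : ℝ), (ε = 1 ∨ ε = -1) → ∀ s : ℝ, s ∈ Ioo 0 τ → ∃ X : ℝ → ℝ, IsSuzukiPhiSolution K ε s X :=
    fun ε hε s hs => exists_isSuzukiPhiSolution_of_noUnitEigenvalue h.continuous_kernel hK0 hε
      (hclean s ⟨hs.1.le, hs.2⟩)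
  have hP : ∀ (ε s : ℝ) (w : ℂ), (∫ y in Ioo (-s) s, (suzukiPhiExt K ε s y : ℂ) * cexp (I * w * y)) =
      ∫ y in Ioo (-s) s, cexp (I * w * y) * (suzukiPhiExt K ε s y : ℂ) :=
    fun ε s w => setIntegral_congr_fun measurableSet_Ioo fun y _ => mul_comm _ _
  have hmodel : ∀ s : ℝ, s ∈ Ioo 0 τ → frakB ϱ K s z =
      I * (1 / 2 * (cexp (I * z * s) * fourier ϱ z - cexp (I * (-z) * s) * fourier ϱ (-z)) +
        1 / 2 * (fourier ϱ z * (∫ y in Ioo (-s) s, cexp (I * z * y) * (suzukiPhiExt K (-1) s y : ℂ)) -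
          fourier ϱ (-z) * ∫ y in Ioo (-s) s, cexp (I * (-z) * y) * (suzukiPhiExt K (-1) s y : ℂ))) := by
    intro s hs
    rw [frakB_def, frakG_def, fourier_frakFG_eq_window h (hsol (-1) (Or.inr rfl) s hs) z, hP, hP]
    push_cast
    ring
  have d1 := hasDerivAt_cexp_I_mul_ofReal z t
  have d2 := hasDerivAt_cexp_I_mul_ofReal (-z) t
  have d3 := hasDerivAt_window_transform (ε := -1) hKd hK0 (Or.inr rfl) hclean ht z
  have d4 := hasDerivAt_window_transform (ε := -1) hKd hK0 (Or.inr rfl) hclean ht (-z)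
  simp only [neg_neg] at d3 d4
  have hD := ((((d1.mul_const (fourier ϱ z)).sub (d2.mul_const (fourier ϱ (-z)))).const_mul (1 / 2 : ℂ)).add
    ((((d3.const_mul (fourier ϱ z)).sub (d4.const_mul (fourier ϱ (-z)))).const_mul (1 / 2 : ℂ)))).const_mul I
  have hEq : (fun s : ℝ => frakB ϱ K s z) =ᶠ[𝓝 t] fun s : ℝ =>
      I * (1 / 2 * (cexp (I * z * s) * fourier ϱ z - cexp (I * (-z) * s) * fourier ϱ (-z)) +
        1 / 2 * (fourier ϱ z * (∫ y in Ioo (-s) s, cexp (I * z * y) * (suzukiPhiExt K (-1) s y : ℂ)) -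
          fourier ϱ (-z) * ∫ y in Ioo (-s) s, cexp (I * (-z) * y) * (suzukiPhiExt K (-1) s y : ℂ))) := by
    filter_upwards [Ioo_mem_nhds ht.1 ht.2] with s hs
    exact hmodel s hs
  refine (hD.congr_of_eventuallyEq hEq).congr_deriv ?_
  have hA : frakA ϱ K t z = 1 / 2 * (cexp (I * z * t) * fourier ϱ z + (1 : ℝ) *
      (cexp (I * (-z) * t) * fourier ϱ (-z))) - (1 : ℝ) / 2 * (fourier ϱ z *
        (∫ y in Ioo (-t) t, cexp (I * z * y) * (suzukiPhiExt K 1 t y : ℂ)) + (1 : ℝ) *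
          (fourier ϱ (-z) * ∫ y in Ioo (-t) t, cexp (I * (-z) * y) * (suzukiPhiExt K 1 t y : ℂ))) := by
    rw [frakA_def, frakF_def, fourier_frakFG_eq_window h (hsol 1 (Or.inl rfl) t ht) z, hP, hP]
  rw [hA, hmodel t ht]
  push_cast
  linear_combination (z / 2 * (cexp (I * z * t) * fourier ϱ z + cexp (I * (-z) * t) * fourier ϱ (-z)
    - fourier ϱ z * (∫ y in Ioo (-t) t, cexp (I * z * y) * (suzukiPhiExt K 1 t y : ℂ))
    - fourier ϱ (-z) * ∫ y in Ioo (-t) t, cexp (I * (-z) * y) * (suzukiPhiExt K 1 t y : ℂ))) * I_mul_I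

/-- **RH-FREE · THM. 3.1 (4) FOR `C¹` KERNELS — THE CANONICAL SYSTEM:** for every Suzuki pair `(ϱ, K)` with
`K ∈ C¹(ℝ)` and every clean range `[0,τ)`, `ᵗ(A(t,z), B(t,z))` solves `∂_tA = zγ(t)B`, `∂_tB = −zγ(t)⁻¹A`
(`γ = m²`, `H = diag(γ⁻¹, γ)`) at EVERY `t ∈ (0,τ)` and every `z ∈ ℂ` — the remaining conjunct of the typed
residual `Suzuki2021_thm31_dynamics`, here with EMPTY exceptional set. Together with `solvesCanonicalSystemOn_Iio`
(…ExtendedSystem) the system holds on `(−∞,0) ∪ (0,τ)`. -/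
theorem thm31_canonical_system (h : IsSuzukiPair ϱ K) (hKd : ContDiff ℝ 1 K) {τ : ℝ}
    (hclean : ∀ s : ℝ, s ∈ Ico 0 τ → NoUnitEigenvalue K s) :
    SolvesCanonicalSystemOn (gamma K) (structA ϱ K) (structB ϱ K) (Ioo 0 τ) := by
  intro z t ht
  have hm := hasDerivAt_m h.continuous_kernel h.kernel_eq_zero hclean ht
  have hmC : HasDerivAt (fun s : ℝ => (m K s : ℂ)) ((mu K t * m K t : ℝ) : ℂ) t := hm.ofReal_comp
  have hminv : HasDerivAt (fun s : ℝ => (m K s)⁻¹) (-(mu K t * m K t) / (m K t) ^ 2) t := hm.inv (m_ne_zero K t)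
  have hminvC : HasDerivAt (fun s : ℝ => (((m K s)⁻¹ : ℝ) : ℂ)) ((-(mu K t * m K t) / (m K t) ^ 2 : ℝ) : ℂ) t :=
    hminv.ofReal_comp
  have hA := hasDerivAt_frakA h hKd hclean ht z
  have hB := hasDerivAt_frakB h hKd hclean ht z
  have hm0 : (m K t : ℂ) ≠ 0 := by exact_mod_cast m_ne_zero K t
  refine ⟨?_, ?_⟩
  · have hd := hmC.mul hA
    refine (hd.congr_of_eventuallyEq (Eventually.of_forall fun s => structA_def ϱ K s z)).congr_deriv ?_
    rw [structB_def, gamma_def]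
    push_cast
    field_simp
    ring
  · have hd := hminvC.mul hB
    refine (hd.congr_of_eventuallyEq (Eventually.of_forall fun s => structB_def ϱ K s z)).congr_deriv ?_
    rw [structA_def, gamma_def]
    push_cast
    field_simp
    ring

/-- **RH-FREE · THE TYPED RESIDUAL'S CONCLUSION FOR `C¹` KERNELS:** for a Suzuki pair with `K ∈ C¹(ℝ)` on a clean range
`[0,τ)`: `A(·,z)`, `B(·,z)` and `m` are continuous on `[0,τ)` and `ᵗ(A,B)` solves the canonical system on `(0,τ) ∖ D`
with `D = ∅` — i.e. exactly the conclusion of `SuzukiStructure.Suzuki2021_thm31_dynamics`, under `ContDiff ℝ 1 K`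
in place of (K4) (and without needing `ContDiff ℝ 1 ϱ` or `τ > 0`). The named fact itself (piecewise-`C¹` kernels) is
NOT asserted. -/
theorem thm31_dynamics_of_contDiff (h : IsSuzukiPair ϱ K) (hKd : ContDiff ℝ 1 K) {τ : ℝ}
    (hclean : ∀ s : ℝ, s ∈ Ico 0 τ → NoUnitEigenvalue K s) :
    (∀ z : ℂ, ContinuousOn (fun t : ℝ => structA ϱ K t z) (Ico 0 τ) ∧
        ContinuousOn (fun t : ℝ => structB ϱ K t z) (Ico 0 τ)) ∧
      ContinuousOn (m K) (Ico 0 τ) ∧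
      ∃ D : Set ℝ, (∀ a b : ℝ, (D ∩ Icc a b).Finite) ∧
        SolvesCanonicalSystemOn (gamma K) (structA ϱ K) (structB ϱ K) (Ioo 0 τ \ D) := by
  obtain ⟨h1, h2⟩ := thm31_continuity h hclean
  refine ⟨h1, h2, ∅, fun a b => by simp, fun z t ht => ?_⟩
  exact thm31_canonical_system h hKd hclean z t ht.1

/-- **RH-FREE · SUZUKI'S THM. 2.2 DYNAMICS FOR `ζ`, UNCONDITIONALLY** (`ω ≥ ½`, `ν ≥ 1`, `νω > 2`): the pair
`(A_ζ^{ω,ν}(t,z), B_ζ^{ω,ν}(t,z))` solves the canonical system with Hamiltonian `H_ζ^{ω,ν}(t) = diag(m(t)⁻², m(t)²)`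
at EVERY `t > 0` and every `z ∈ ℂ` (all windows are clean by `suzuki2021_windows_of_half_le'`; `K_ζ ∈ C¹` by
…ZetaRegularity). With `solvesCanonicalSystemOn_zeta_Iio` the system also holds on `(−∞,0)`. NOT CLAIMED: anything about
`t → ∞` (`J`-limits, `E(t,·) ∈ ℍ𝔹̄`, Thm. 2.4) — that is where RH lives. -/
theorem solvesCanonicalSystemOn_zeta {ω : ℝ} (hω : 1 / 2 ≤ ω) {ν : ℕ} (hν : 1 ≤ ν) (hνω : 2 < (ν : ℝ) * ω) :
    SolvesCanonicalSystemOn (gamma (suzukiKernel ω ν)) (suzukiAt ω ν) (suzukiBt ω ν) (Ioi 0) := by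
  intro z t ht
  have ht' : 0 < t := ht
  have hclean : ∀ s : ℝ, s ∈ Ico 0 (t + 1) → NoUnitEigenvalue (suzukiKernel ω ν) s :=
    fun s hs => suzuki2021_windows_of_half_le' hω hν (by linarith) hs.1
  have hK1 : ContDiff ℝ 1 (suzukiKernel ω ν) := by
    have h := contDiff_suzukiKernel (by linarith : 0 < ω) (ν := ν) (k := 1) (by push_cast; linarith)
    simpa using h
  exact thm31_canonical_system (isSuzukiPair_zeta (by linarith) hν (by linarith)) hK1 hclean z t ⟨ht', by linarith⟩

/-- RH-FREE. The `ζ` case packaged as the residual's conclusion: for `ω ≥ ½`, `ν ≥ 1`, `νω > 2` and every `τ`,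
continuity of `A_ζ, B_ζ, m_ζ` on `[0,τ)` and the canonical system on `(0,τ)` (exceptional set `∅`) — the conclusion of
`Suzuki2021_thm31_dynamics` for the `ζ` data, now UNCONDITIONAL (compare `solvesCanonicalSystemOn_zeta_of_thm31` of
…ZetaRegularity, which assumed the named fact). -/
theorem thm22_dynamics_zeta {ω : ℝ} (hω : 1 / 2 ≤ ω) {ν : ℕ} (hν : 1 ≤ ν) (hνω : 2 < (ν : ℝ) * ω) (τ : ℝ) :
    (∀ z : ℂ, ContinuousOn (fun t : ℝ => suzukiAt ω ν t z) (Ico 0 τ) ∧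
        ContinuousOn (fun t : ℝ => suzukiBt ω ν t z) (Ico 0 τ)) ∧
      ContinuousOn (m (suzukiKernel ω ν)) (Ico 0 τ) ∧
      ∃ D : Set ℝ, (∀ a b : ℝ, (D ∩ Icc a b).Finite) ∧
        SolvesCanonicalSystemOn (gamma (suzukiKernel ω ν)) (suzukiAt ω ν) (suzukiBt ω ν) (Ioo 0 τ \ D) := by
  have hclean : ∀ s : ℝ, s ∈ Ico 0 τ → NoUnitEigenvalue (suzukiKernel ω ν) s :=
    fun s hs => suzuki2021_windows_of_half_le' hω hν (by linarith) hs.1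
  have hK1 : ContDiff ℝ 1 (suzukiKernel ω ν) := by
    have h := contDiff_suzukiKernel (by linarith : 0 < ω) (ν := ν) (k := 1) (by push_cast; linarith)
    simpa using h
  exact thm31_dynamics_of_contDiff (isSuzukiPair_zeta (by linarith) hν (by linarith)) hK1 hclean

end Summit.RiemannHypothesis.RiemannHypothesis.Theorems.SuzukiStructureFunctions
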